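import Summits.ResolutionOfSingularities.ResolutionOfSingularities.Theorems.FrobeniusLadderFInjectiveMacaulayficationSliceableCentre
import Mathlib.RingTheory.Regular.Flat
import Mathlib.RingTheory.Flat.FaithfullyFlat.Algebra
import Mathlib.RingTheory.Finiteness.Ideal
import HarnessLib

/-!
# GAP-2 «k ≠ k̄» engine (B): FULL (and the CM clause) DESCENDS along faithfully flat extensions of local rings with zero-dimensional closed fibre
# (crux `FInjectiveMacaulayfication` stmt-ResolutionOfSingularities-15315, chain w45a; seat res-L1-w45a-stub-2 g12, OFFER (B) of the 03:42Z PROGRESS line: the residual of GAP-2 «k ≠ k̄»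
# beyond the class — singular closed points whose residue field is a proper extension of `k` — is a base-change-and-descend problem; this file is the DESCENT half, in pure commutative
# algebra, reusable for completion / Henselisation / ground-field extension alike)

[OURS · L1 W4.5a] Support file (`--supports stmt-ResolutionOfSingularities-15315 --as helper`); def-free; UNCONDITIONAL; no named fact; NOT a statement of any manuscript.
AI-written (AI review is weaker than expert review). Nothing of the crux is proved here.

THE STATEMENT. `A → B` a FAITHFULLY FLAT algebra of local rings, `A` Noetherian, `dim A = dim B`, and the closed fibre zero-dimensional in the form `√(𝔪_A B) = 𝔪_B`. Then
`FullCl p B → FullCl p A` (`SliceableCentre.FullCl`: domain ∧ every system of parameters weakly regular ∧ parameter ideals Frobenius-closed), and likewise for the CM clause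
`CMCl`. Proof: (i) `A ↪ B` (faithful flatness), so `A` is a domain; (ii) a system of parameters `s` of `A` maps to one of `B` (`𝔪_A^N ⊆ (s)` by Noetherianity, so
`√((s)B) ⊇ √(𝔪_A B) = 𝔪_B`, and `(s)B ⊆ 𝔪_B`); (iii) weak regularity of `s` on `B` DESCENDS to `A` — the faithfully-flat converse of Mathlib's
`RingTheory.Sequence.IsWeaklyRegular.of_flat_of_isBaseChange`, proved here by the same induction with `Module.FaithfullyFlat.lTensor_injective_iff_injective`;
(iv) Frobenius-closedness descends by `Ideal.comap_map_eq_self_of_faithfullyFlat` (`(s)B ∩ A = (s)`).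
* §1 `isSMulRegular_of_faithfullyFlat_of_isBaseChange`, ★ `isWeaklyRegular_of_faithfullyFlat_of_isBaseChange`, `isWeaklyRegular_of_faithfullyFlat` (descent of weakly regular
  sequences along faithfully flat base change — not in Mathlib, which has the ascent);
* §2 `radical_span_map_isMaximal` (a s.o.p. of `A` generates an `𝔪_B`-primary ideal), `pow_mem_span_frobenius_map` (plumbing for the F-clause);
* §3 ★★ `fullCl_of_faithfullyFlat`, ★ `cmCl_of_faithfullyFlat`.
USE. Ground-field extension at a closed point (`𝒪_{X,x} → 𝒪_{X_K,x'}`, flat local, fibre `κ(x) ⊗_k K` Artinian), completion `A → Â`, strict Henselisation: in each case FULLness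
proved upstairs (e.g. by a normal form or by the `k = k̄` class theorems) comes down to `A`. The hypotheses `dim A = dim B` and `√(𝔪_A B) = 𝔪_B` are supplied per use.
[cite: Matsumura1987, Thm. 7.5 and Thm. 23.3 (flat descent; the CM property along flat local maps)] [cite: StacksProject, Tag 00LM]
-/

-- single-problem summit: the doubled namespace component is forced
set_option linter.dupNamespace false

noncomputable section

open TensorProduct

namespace Summit.ResolutionOfSingularities.ResolutionOfSingularities.Theorems.FInjectiveMacaulayfication.FullClDescent

open Summit.ResolutionOfSingularities.ResolutionOfSingularities.Theorems.FInjectiveMacaulayfication SliceableCentre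

/-! ## §1 Descent of weakly regular sequences along faithfully flat base change -/

section Descent

variable {R S M N : Type} [CommRing R] [CommRing S] [Algebra R S]
  [AddCommGroup M] [Module R M] [AddCommGroup N] [Module R N] [Module S N] [IsScalarTower R S N]

/-- **`M`-regularity of `x ∈ R` DESCENDS from the faithfully flat base change `N = S ⊗ M`.** (Converse of Mathlib's `IsSMulRegular.of_flat_of_isBaseChange`.)
[folklore; cite: Matsumura1987, Thm. 7.5] -/
theorem isSMulRegular_of_faithfullyFlat_of_isBaseChange [Module.FaithfullyFlat R S] {f : M →ₗ[R] N} (hf : IsBaseChange S f) {x : R}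
    (reg : IsSMulRegular N (algebraMap R S x)) : IsSMulRegular M x := by
  -- `hf.equiv ∘ (x • ·) ⊗ S = (algebraMap x • ·) ∘ hf.equiv` on `S ⊗[R] M`
  have key : ∀ z : S ⊗[R] M, hf.equiv ((LinearMap.lsmul R M x).lTensor S z) = algebraMap R S x • hf.equiv z := by
    intro z
    induction z using TensorProduct.induction_on with
    | zero => simp only [map_zero, smul_zero]
    | tmul s m =>
      rw [LinearMap.lTensor_tmul, LinearMap.lsmul_apply, IsBaseChange.equiv_tmul, IsBaseChange.equiv_tmul, map_smul, algebraMap_smul]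
      exact smul_comm _ _ _
    | add a b ha hb => simp only [map_add, smul_add, ha, hb]
  have h' : Function.Injective ((LinearMap.lsmul R M x).lTensor S) := by
    intro z₁ z₂ hz
    have hz' := congrArg hf.equiv hz
    rw [key, key] at hz'
    exact hf.equiv.injective (reg hz')
  intro a b hab
  exact (Module.FaithfullyFlat.lTensor_injective_iff_injective R S (LinearMap.lsmul R M x)).mp h' hab

/-- ★ **WEAKLY REGULAR SEQUENCES DESCEND ALONG FAITHFULLY FLAT BASE CHANGE**: if `N` is the base change of `M` to the faithfully flat `R`-algebra `S` and the image of
`[r₁, …, rₙ]` is weakly `N`-regular, then `[r₁, …, rₙ]` is weakly `M`-regular. (Converse of Mathlib's `IsWeaklyRegular.of_flat_of_isBaseChange`, same induction.)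
[folklore; cite: Matsumura1987, Thm. 7.5] -/
theorem isWeaklyRegular_of_faithfullyFlat_of_isBaseChange [Module.FaithfullyFlat R S] {f : M →ₗ[R] N} (hf : IsBaseChange S f)
    {rs : List R} (reg : RingTheory.Sequence.IsWeaklyRegular N (rs.map (algebraMap R S))) : RingTheory.Sequence.IsWeaklyRegular M rs := by
  induction rs generalizing M N with
  | nil => exact RingTheory.Sequence.IsWeaklyRegular.nil R M
  | cons x _ ih =>
    simp only [List.map_cons, RingTheory.Sequence.isWeaklyRegular_cons_iff] at reg ⊢
    have e := (QuotSMulTop.algebraMapTensorEquivTensorQuotSMulTop x M S).symm ≪≫ₗ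
      QuotSMulTop.congr ((algebraMap R S) x) hf.equiv
    have hg : IsBaseChange S <|
        e.toLinearMap.restrictScalars R ∘ₗ TensorProduct.mk R S (QuotSMulTop x M) 1 :=
      IsBaseChange.of_equiv e (fun _ => by simp)
    exact ⟨isSMulRegular_of_faithfullyFlat_of_isBaseChange hf reg.1, ih hg reg.2⟩

/-- The case `M = R`, `N = S`. [folklore] -/
theorem isWeaklyRegular_of_faithfullyFlat [Module.FaithfullyFlat R S] {rs : List R}
    (reg : RingTheory.Sequence.IsWeaklyRegular S (rs.map (algebraMap R S))) : RingTheory.Sequence.IsWeaklyRegular R rs :=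
  isWeaklyRegular_of_faithfullyFlat_of_isBaseChange (IsBaseChange.linearMap R S) reg

end Descent

/-! ## §2 Systems of parameters and Frobenius powers along the structure map -/

variable {A B : Type} [CommRing A] [CommRing B] [Algebra A B]

/-- **A system of parameters of `A` generates an `𝔪_B`-primary ideal of `B`** when `A` is Noetherian local, `B` local and `√(𝔪_A B) = 𝔪_B`. [folklore; cite: Matsumura1987, §14] -/
theorem radical_span_map_isMaximal [IsNoetherianRing A] [IsLocalRing A] [IsLocalRing B]
    (hfib : ((IsLocalRing.maximalIdeal A).map (algebraMap A B)).radical = IsLocalRing.maximalIdeal B)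
    {d : ℕ} (s : Fin d → A) (hs : (Ideal.span (Set.range s)).radical.IsMaximal) :
    (Ideal.span (Set.range (fun i => algebraMap A B (s i)))).radical.IsMaximal := by
  have hmax : (Ideal.span (Set.range s)).radical = IsLocalRing.maximalIdeal A := IsLocalRing.eq_maximalIdeal hs
  have hmap : Ideal.span (Set.range (fun i => algebraMap A B (s i))) = (Ideal.span (Set.range s)).map (algebraMap A B) := by
    rw [Ideal.map_span, ← Set.range_comp (algebraMap A B) s]
    rfl
  -- `𝔪_A^N ⊆ (s)`
  obtain ⟨N, hN⟩ := Ideal.exists_pow_le_of_le_radical_of_fg (le_of_eq hmax.symm) (IsNoetherian.noetherian (IsLocalRing.maximalIdeal A))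
  -- `𝔪_B ⊆ √((s)B)`
  have hge : IsLocalRing.maximalIdeal B ≤ (Ideal.span (Set.range (fun i => algebraMap A B (s i)))).radical := by
    rw [← hfib, hmap]
    have hN' : ((IsLocalRing.maximalIdeal A).map (algebraMap A B)) ^ N ≤ (Ideal.span (Set.range s)).map (algebraMap A B) := by
      rw [← Ideal.map_pow]
      exact Ideal.map_mono hN
    refine Ideal.radical_le_radical_iff.mpr fun b hb => ?_
    exact ⟨N, hN' (Ideal.pow_mem_pow hb N)⟩
  -- `(s)B ⊆ 𝔪_B`, hence `√((s)B) ≠ ⊤`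
  have hle : Ideal.span (Set.range (fun i => algebraMap A B (s i))) ≤ IsLocalRing.maximalIdeal B := by
    rw [Ideal.span_le]
    rintro _ ⟨i, rfl⟩
    have hsi : s i ∈ IsLocalRing.maximalIdeal A := by
      rw [← hmax]
      exact Ideal.le_radical (Ideal.subset_span ⟨i, rfl⟩)
    have : algebraMap A B (s i) ∈ (IsLocalRing.maximalIdeal A).map (algebraMap A B) := Ideal.mem_map_of_mem _ hsi
    rw [← hfib]
    exact Ideal.le_radical this
  have hradle : (Ideal.span (Set.range (fun i => algebraMap A B (s i)))).radical ≤ IsLocalRing.maximalIdeal B :=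
    ((IsLocalRing.maximalIdeal.isMaximal B).isPrime.radical_le_iff).mpr hle
  rw [le_antisymm hradle hge]
  exact IsLocalRing.maximalIdeal.isMaximal B

/-- The Frobenius-power ideal `((·)^{q}) '' (s)` maps into the one of `(s)B`. [plumbing] -/
theorem pow_mem_span_frobenius_map (q : ℕ) {d : ℕ} (s : Fin d → A) (y : A)
    (hy : y ^ q ∈ Ideal.span ((fun z : A => z ^ q) '' (Ideal.span (Set.range s) : Set A))) :
    (algebraMap A B y) ^ q ∈ Ideal.span ((fun z : B => z ^ q) '' (Ideal.span (Set.range (fun i => algebraMap A B (s i))) : Set B)) := by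
  have hmap : Ideal.span (Set.range (fun i => algebraMap A B (s i))) = (Ideal.span (Set.range s)).map (algebraMap A B) := by
    rw [Ideal.map_span, ← Set.range_comp (algebraMap A B) s]
    rfl
  have h := Ideal.mem_map_of_mem (algebraMap A B) hy
  rw [map_pow, Ideal.map_span] at h
  refine Ideal.span_mono ?_ h
  rintro _ ⟨_, ⟨z, hz, rfl⟩, rfl⟩
  refine ⟨algebraMap A B z, ?_, by simp only [map_pow]⟩
  rw [hmap]
  exact Ideal.mem_map_of_mem _ hz

/-! ## §3 ★★ FULL and CM descend -/

/-- ★★ **FULL DESCENDS ALONG FAITHFULLY FLAT LOCAL EXTENSIONS WITH ZERO-DIMENSIONAL CLOSED FIBRE.** `A` Noetherian local, `B` local, `A → B` faithfully flat with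
`dim B = dim A` and `√(𝔪_A B) = 𝔪_B`: `FullCl p B → FullCl p A`. [folklore; cite: Matsumura1987, Thm. 7.5 and Thm. 23.3; StacksProject, Tag 00LM] -/
theorem fullCl_of_faithfullyFlat (p : ℕ) [IsNoetherianRing A] [IsLocalRing A] [IsLocalRing B] [Module.FaithfullyFlat A B]
    (hdim : ringKrullDim B = ringKrullDim A)
    (hfib : ((IsLocalRing.maximalIdeal A).map (algebraMap A B)).radical = IsLocalRing.maximalIdeal B)
    (hB : FullCl p B) : FullCl p A := by
  haveI : IsDomain B := hB.1
  refine ⟨Function.Injective.isDomain (algebraMap A B) (FaithfulSMul.algebraMap_injective A B), fun d hd s hs => ?_⟩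
  have hs' := radical_span_map_isMaximal hfib s hs
  obtain ⟨hreg', hF'⟩ := hB.2 d (hdim.trans hd) (fun i => algebraMap A B (s i)) hs'
  refine ⟨?_, fun y ⟨e, hy⟩ => ?_⟩
  · -- weak regularity descends
    refine isWeaklyRegular_of_faithfullyFlat (R := A) (S := B) ?_
    rw [List.map_ofFn]
    exact hreg'
  · -- Frobenius-closedness descends: `(s)B ∩ A = (s)`
    have hyB : algebraMap A B y ∈ Ideal.span (Set.range (fun i => algebraMap A B (s i))) :=
      hF' (algebraMap A B y) ⟨e, pow_mem_span_frobenius_map (p ^ e) s y hy⟩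
    have hmap : Ideal.span (Set.range (fun i => algebraMap A B (s i))) = (Ideal.span (Set.range s)).map (algebraMap A B) := by
      rw [Ideal.map_span, ← Set.range_comp]
      rfl
    rw [hmap] at hyB
    have : y ∈ ((Ideal.span (Set.range s)).map (algebraMap A B)).comap (algebraMap A B) := hyB
    rwa [Ideal.comap_map_eq_self_of_faithfullyFlat] at this

/-- ★ **THE CM CLAUSE DESCENDS** along the same maps: `CMCl B → CMCl A`. [folklore; cite: Matsumura1987, Thm. 23.3] -/
theorem cmCl_of_faithfullyFlat [IsNoetherianRing A] [IsLocalRing A] [IsLocalRing B] [Module.FaithfullyFlat A B]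
    (hdim : ringKrullDim B = ringKrullDim A)
    (hfib : ((IsLocalRing.maximalIdeal A).map (algebraMap A B)).radical = IsLocalRing.maximalIdeal B)
    (hB : CMCl B) : CMCl A := by
  intro d hd s hs
  have hreg' := hB d (hdim.trans hd) (fun i => algebraMap A B (s i)) (radical_span_map_isMaximal hfib s hs)
  refine isWeaklyRegular_of_faithfullyFlat (R := A) (S := B) ?_
  rw [List.map_ofFn]
  exact hreg'

end Summit.ResolutionOfSingularities.ResolutionOfSingularities.Theorems.FInjectiveMacaulayfication.FullClDescent

end
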